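import Literature.IUT.LogVolume.TorsionPointsFacts
import HarnessLib

/-!
# [IUTchIV] Proposition 1.8: (iv) follows from (i) and (ii) — proof over the interface

`Proofs` companion (theorems only; no definitions, no named facts, no instances) of
`Literature.IUT.LogVolume.TorsionPointsFacts` (abc-iut-S2/S3), which types S. Mochizuki,
*Inter-universal Teichmüller theory IV* (kurims Apr-2020 manuscript), Prop. 1.8 (i)–(vii) pp. 18–19
as named `Prop`s `P18_i, …, P18_vii` over the interface `Prop18.TorsionSetting`. Written by the
cell `abc-iut` (seat abc-iut-L5-t12).

The printed proof of (iv) (p. 20, l. 25–33) is an argument INSIDE that interface: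

> "Next, we consider assertion (iv). First, let us observe that it follows immediately from the
> final portion of assertion (ii) that a model `E*_k` of `E_k̄` over `k` all of whose `l`-torsion
> points are rational over `k` corresponds to a closed subgroup `H* ⊆ Aut_k(E_k̄)` that lies in the
> kernel of `ρ_l` and, moreover, maps isomorphically to `G_k`. On the other hand, it follows from
> assertion (i) that the restriction of `ρ_l` to `Aut_k̄(E_k̄) ⊆ Aut_k(E_k̄)` is injective. Thus,
> the closed subgroup `H* ⊆ Aut_k(E_k̄)` is uniquely determined by the condition that it lie in the
> kernel of `ρ_l` and, moreover, map isomorphically to `G_k`. This completes the proof of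
> assertion (iv)."

and it goes through verbatim for the typed `Prop`s: two sections `s, s′` of `Aut_k(E_k̄) → G_k`
over `G_k` (models over `k`, by the last sentence of (ii) — the interface's DEFINITION `Model`)
killed by `ρ_l` differ by the cocycle `h ↦ s′(h)s(h)⁻¹` with values in
`Ker(Aut_k(E_k̄) → G_k) = Aut_k̄(E_k̄)` (exactness, part of `P18_ii`) on which `ρ_l` vanishes, hence
trivial by Serre's criterion `P18_i`; so `s = s′`, in particular the models are isomorphic
(`ModelIso`, with `a = 1`). Consequently `P18_iv` is NOT an independent named fact:
`TorsionSetting.p18_iv_of_p18_i_ii`, and `S.P18` is equivalent to the conjunction of the other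
six (`TorsionSetting.p18_iff`). Only the exactness clause `Ker ⊆ Im` of (ii) is used
(`p18_iv_of_p18_i_of_ker_le_range`).

The REAL form of (iv) for Weierstrass curves (two `k`-models with `k`-rational `l`-torsion are
`k`-isomorphic) is proved in `Literature.NumberTheory.EllipticCurves.TorsionRationalDescentProofs`.
Nothing here takes a side on [IUTchIII] Cor. 3.12; Prop. 1.8 is classical ("well-known elementary
facts", p. 18).

## References

* [Mochizuki2012] S. Mochizuki, IUT IV, Prop. 1.8 (i), (ii), (iv) pp. 18–19; proof of (iv) p. 20.
* [Milne1986AbelianVarieties] J. S. Milne, *Abelian Varieties*, Prop. 17.5 (Serre's criterion).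
-/

namespace Literature.IUT.LogVolume

namespace Prop18

namespace TorsionSetting

variable (S : TorsionSetting)

/-- **Two models over `k` with rational `l`-torsion have EQUAL sections**, given Serre's criterion
(i) and the exactness `Ker(Aut_k(E_k̄) → G_k) ⊆ Aut_k̄(E_k̄)` of (ii): the printed proof of
[IUTchIV] Prop. 1.8 (iv), p. 20 ("the closed subgroup `H*` … is uniquely determined by the
condition that it lie in the kernel of `ρ_l` and … map isomorphically to `G_k`").
[claim: Mochizuki2012, status: disputed] -/
theorem model_eq_of_torsionRational (hi : S.P18_i) (hker : S.proj.ker ≤ S.incl.range) {l : ℕ}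
    (hl : l.Prime) (hl3 : 3 ≤ l) (hlk : S.charUnitK l) (s s' : S.Model ⊤)
    (hs : S.TorsionRational s l) (hs' : S.TorsionRational s' l) (h : (⊤ : Subgroup S.Gk)) :
    s'.1 h = s.1 h := by
  -- the cocycle `g := s′(h) s(h)⁻¹` lies over `1 ∈ G_k` …
  set g : S.AutK := s'.1 h * (s.1 h)⁻¹ with hg
  have hgker : g ∈ S.proj.ker := by
    rw [MonoidHom.mem_ker, hg, map_mul, map_inv, s'.2 h, s.2 h, mul_inv_cancel]
  -- … hence comes from `Aut_k̄(E_k̄)` …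
  obtain ⟨b, hb⟩ := hker hgker
  -- … and is killed by `ρ_l`
  have hρs : S.ρ l (s.1 h) = 1 := hs h
  have hρs' : S.ρ l (s'.1 h) = 1 := hs' h
  have hρinv : S.ρ l (s.1 h)⁻¹ = 1 := by
    have := map_mul (S.ρ l) (s.1 h)⁻¹ (s.1 h)
    rw [inv_mul_cancel, map_one, hρs, mul_one] at this
    exact this.symm
  have hρg : S.ρ l g = 1 := by rw [hg, map_mul, hρs', hρinv, mul_one]
  -- Serre's criterion: `b = 1`
  have hb1 : b = 1 := by
    apply hi l hl hl3 hlk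
    rw [MonoidHom.comp_apply, hb, hρg, map_one]
  have hg1 : g = 1 := by rw [← hb, hb1, map_one]
  exact mul_inv_eq_one.mp hg1

/-- **[IUTchIV] Prop. 1.8 (iv) over the interface, from (i) and the exactness clause of (ii)**
(printed proof p. 20, l. 25–33): two models of `E_k̄` over `k` all of whose `l`-torsion points are
rational over `k` (`l ≥ 3` prime invertible in `k`) are isomorphic over `k` — indeed their
sections coincide (`model_eq_of_torsionRational`), so `ModelIso` holds with `a = 1`.
[claim: Mochizuki2012, status: disputed] -/
theorem p18_iv_of_p18_i_of_ker_le_range (hi : S.P18_i) (hker : S.proj.ker ≤ S.incl.range) :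
    S.P18_iv := by
  intro l hl hl3 hlk s s' hs hs'
  refine ⟨1, fun h => ?_⟩
  rw [map_one, one_mul, inv_one, mul_one]
  exact S.model_eq_of_torsionRational hi hker hl hl3 hlk s s' hs hs' h

/-- **[IUTchIV] Prop. 1.8 (iv) follows from (i) and (ii)** over the interface
`Prop18.TorsionSetting` (the printed proof, p. 20). [claim: Mochizuki2012, status: disputed] -/
theorem p18_iv_of_p18_i_ii (hi : S.P18_i) (hii : S.P18_ii) : S.P18_iv :=
  S.p18_iv_of_p18_i_of_ker_le_range hi (le_of_eq hii.2.1.symm)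

/-- Hence the conjunction `S.P18` of [IUTchIV] Prop. 1.8 (i)–(vii) is equivalent to the conjunction
of (i), (ii), (iii), (v), (vi), (vii): clause (iv) is not an independent named fact.
[claim: Mochizuki2012, status: disputed] -/
theorem p18_iff : S.P18 ↔ S.P18_i ∧ S.P18_ii ∧ S.P18_iii ∧ S.P18_v ∧ S.P18_vi ∧ S.P18_vii := by
  constructor
  · rintro ⟨hi, hii, hiii, -, hv, hvi, hvii⟩
    exact ⟨hi, hii, hiii, hv, hvi, hvii⟩
  · rintro ⟨hi, hii, hiii, hv, hvi, hvii⟩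
    exact ⟨hi, hii, hiii, S.p18_iv_of_p18_i_ii hi hii, hv, hvi, hvii⟩

end TorsionSetting

end Prop18

end Literature.IUT.LogVolume
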